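import Mathlib
import HarnessLib
import Summits.NavierStokesRegularity.NavierStokesRegularity.Theorems.UnthreadedDoorAntidynamoWallAntiTwinDrift
import Summits.NavierStokesRegularity.NavierStokesRegularity.Theorems.UnthreadedDoorAntidynamoWallCorotatingPattern

/-!
# Route `UnthreadedDoor` / `ThreadingFlux`, crux `PoloidalLiouville` (stmt-NavierStokesRegularity-1222), antidynamo v2 skeleton (4ebf5683127b),
# WALL `stub_scalarLiouville`: ANTI-SCREW / ANTI-PERIODIC VORTICITY IS TRIVIAL

Support file (seat leafhand-ns-unthreadeddoor-2 g1, cell decomp-ns), `--supports stmt-NavierStokesRegularity-1222 --as helper`; theorems only.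

The screw twin of p816639 (`u(s,x) = R⁻¹ v(s + τ, x₀ + R(x − x₀))`, `τ ≤ 0`, a member of the class by `CellFlux.isBoundedAncientMildSolution_frame`) is an
ANTI-twin exactly when the vorticity at time `s + τ` is MINUS the `R`-rotation of the vorticity at time `s`.  The anti-twin machinery of p816874
(drift–heat equation, Galilean frame, heat Liouville, tangency) then gives:

* ★★★ `curl_eq_zero_of_curl_antiscrew` — class + unthreaded about `x₀` + `curl v(s + τ)(x₀ + R y) = −det R • R (curl v(s)(x₀ + y))` for all `s < 0`, `y`
  (a linear isometry `R`, `τ ≤ 0`) ⇒ `curl v ≡ 0` on `(−∞,0) × ℝ³`.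
* ★★★ `curl_eq_zero_of_curl_antiperiodic` — ANTI-PERIODIC vorticity, `curl v(s − τ) = −curl v(s)` for all `s < 0` (`τ > 0`), is trivial (`R = 1`) —
  in contrast with periodic vorticity, which only collapses to exactly periodic flows (p816327).
* `constant_…` versions.

HONEST LABEL: corollaries of p816874 + the twin construction of p816639; nothing here proves `stub_scalarLiouville`, `PoloidalLiouville` (1222), or bears
on Navier–Stokes regularity; no summit statement is proved (crux 1222 is INCOMPARABLE with the summit). [folklore]
[cite: KochNadirashviliSereginSverak2009, Thm 5.2 (arXiv:0709.3599 pp. 9–10)]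
-/

noncomputable section

-- the summit and its single sub-problem share the name (CONVENTIONS §1)
set_option linter.dupNamespace false

open scoped Topology InnerProductSpace RealInnerProductSpace ContDiff Laplacian
open Filter Set Function Metric MeasureTheory
open Literature.Analysis.FluidPDE

namespace Summit.NavierStokesRegularity.NavierStokesRegularity.Theorems.PoloidalLiouville.Antidynamo

open Summit.NavierStokesRegularity.NavierStokesRegularity.Theorems.PoloidalLiouville
  (constantOfIrrotational vorticityOfClass)
open Summit.NavierStokesRegularity.FluidComputer.AngularLadder (det_symm_eq_det)

/-- ★★★ **ANTI-SCREW VORTICITY ⇒ IRROTATIONAL.**  Let `v` be a bounded ancient mild solution (`ν = 1`, duality class) with measurable slices, jointly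
smooth on `(−∞,0) × ℝ³` and unthreaded about `x₀`; let `R` be a linear isometry and `τ ≤ 0`.  If for every `s < 0` the vorticity at time `s + τ` is
MINUS the `R`-rotation about `x₀` of the vorticity at time `s`, `curl v(s + τ)(x₀ + R y) = −(det R • R (curl v(s)(x₀ + y)))`, then `curl v ≡ 0` on
`(−∞,0) × ℝ³`. [cite: KochNadirashviliSereginSverak2009, Thm 5.2 (arXiv:0709.3599 pp. 9–10)] -/
theorem curl_eq_zero_of_curl_antiscrew
    (v : ℝ → EuclideanSpace ℝ (Fin 3) → EuclideanSpace ℝ (Fin 3)) (x₀ : EuclideanSpace ℝ (Fin 3))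
    (hB : Literature.Analysis.FluidPDE.IsBoundedAncientMildSolution 1 v)
    (hm : ∀ t < 0, AEStronglyMeasurable (v t) volume)
    (hsm : ContDiffOn ℝ (⊤ : ℕ∞) (Function.uncurry v) (Set.Iio 0 ×ˢ Set.univ))
    (hun : ∀ t < 0, ∀ x, ⟪x - x₀, curl (v t) x⟫ = 0)
    (R : EuclideanSpace ℝ (Fin 3) ≃ₗᵢ[ℝ] EuclideanSpace ℝ (Fin 3)) {τ : ℝ} (hτ : τ ≤ 0)
    (hanti : ∀ s < 0, ∀ y, curl (v (s + τ)) (x₀ + R y) =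
      -((R : EuclideanSpace ℝ (Fin 3) →L[ℝ] EuclideanSpace ℝ (Fin 3)).det • R (curl (v s) (x₀ + y)))) :
    ∀ t < 0, ∀ x, curl (v t) x = 0 := by
  have hsm' : IsSmoothSpaceTimeOn (Iio 0) v := hsm
  -- the screw twin `u(s, x) = R⁻¹ v(s + τ, x₀ + R (x − x₀)) = R⁻¹ v(s + τ, R x + c)` (as in p816639)
  set c : EuclideanSpace ℝ (Fin 3) := x₀ - R x₀ with hc
  set u : ℝ → EuclideanSpace ℝ (Fin 3) → EuclideanSpace ℝ (Fin 3) := fun s y => R.symm (v (s + τ) (R y + c)) with hu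
  have hBu : Literature.Analysis.FluidPDE.IsBoundedAncientMildSolution 1 u := by
    have h := CellFlux.isBoundedAncientMildSolution_frame hB R.symm c hτ
    have e : (fun s y => R.symm (v (s + τ) (R.symm.symm y + c))) = u := by
      funext s y
      rw [LinearIsometryEquiv.symm_symm]
    rw [e] at h
    exact h
  have hus : ∀ s < 0, ContDiff ℝ ∞ (u s) := fun s hs =>
    R.symm.contDiff.comp ((hsm'.contDiff_slice (show s + τ < 0 by linarith)).comp (R.contDiff.add contDiff_const))
  have hmu : ∀ s < 0, AEStronglyMeasurable (u s) volume := fun s hs => (hus s hs).continuous.aestronglyMeasurable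
  have hmap : ContDiff ℝ (⊤ : ℕ∞) fun p : ℝ × EuclideanSpace ℝ (Fin 3) => (p.1 + τ, R p.2 + c) :=
    (contDiff_fst.add contDiff_const).prodMk ((R.contDiff.comp contDiff_snd).add contDiff_const)
  have hmaps : MapsTo (fun p : ℝ × EuclideanSpace ℝ (Fin 3) => (p.1 + τ, R p.2 + c)) (Iio 0 ×ˢ univ) (Iio 0 ×ˢ univ) :=
    fun p hp => ⟨by have h1 : p.1 < 0 := hp.1; show p.1 + τ < 0; linarith, mem_univ _⟩
  have hsmu : ContDiffOn ℝ (⊤ : ℕ∞) (Function.uncurry u) (Set.Iio 0 ×ˢ Set.univ) :=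
    R.symm.contDiff.comp_contDiffOn (hsm.comp hmap.contDiffOn hmaps)
  -- the OPPOSITE vorticity
  have hcu : ∀ s < 0, ∀ x, curl (u s) x = -curl (v s) x := by
    intro s hs x
    have h1 : curl (u s) x = (R.symm : EuclideanSpace ℝ (Fin 3) →L[ℝ] EuclideanSpace ℝ (Fin 3)).det •
        R.symm (curl (v (s + τ)) (R.symm.symm x + c)) := by
      rw [hu]
      exact curl_conj_rigidMotion R.symm c (v (s + τ)) x
    have e1 : R.symm.symm x + c = x₀ + R (x - x₀) := by
      rw [LinearIsometryEquiv.symm_symm, hc, map_sub]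
      abel
    rw [h1, e1, hanti s hs (x - x₀), add_sub_cancel, map_neg, map_smul, LinearIsometryEquiv.symm_apply_apply, smul_neg,
      smul_smul, det_symm_eq_det, det_linearIsometryEquiv_mul_self, one_smul]
  -- anti-twin with drift `k(s) = u(s,x₀) + v(s,x₀)`, smooth on `(−∞,0)`
  set k : ℝ → EuclideanSpace ℝ (Fin 3) := fun s => u s x₀ + v s x₀ with hk
  have hanti' : ∀ s < 0, ∀ y, u s y = k s - v s y := antiTwin_eq_const_sub x₀ hB hsm hBu hsmu hcu
  have hcv : ContDiffOn ℝ ∞ (fun s : ℝ => v s x₀) (Iio 0) :=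
    hsm.comp (contDiff_id.prodMk contDiff_const).contDiffOn fun s hs => ⟨hs, mem_univ _⟩
  have hcu0 : ContDiffOn ℝ ∞ (fun s : ℝ => u s x₀) (Iio 0) :=
    hsmu.comp (contDiff_id.prodMk contDiff_const).contDiffOn fun s hs => ⟨hs, mem_univ _⟩
  have hk_smooth : ContDiffOn ℝ ∞ k (Iio 0) := hcu0.add hcv
  obtain ⟨hV, K, hK⟩ := vorticityOfClass v hB hm hsm
  obtain ⟨hU, -⟩ := vorticityOfClass u hBu hmu hsmu
  exact curl_eq_zero_of_driftCaloric_unthreaded hV hK x₀ hun k hk_smooth fun t ht x =>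
    timeDerivWithin_vorticity_eq_of_antiTwin hV hU k hanti' ht x

/-- ★★★ **… HENCE SLICE-WISE CONSTANT.** [cite: KochNadirashviliSereginSverak2009, Thm 5.2 (arXiv:0709.3599 pp. 9–10)] -/
theorem constant_of_curl_antiscrew
    (v : ℝ → EuclideanSpace ℝ (Fin 3) → EuclideanSpace ℝ (Fin 3)) (x₀ : EuclideanSpace ℝ (Fin 3))
    (hB : Literature.Analysis.FluidPDE.IsBoundedAncientMildSolution 1 v)
    (hm : ∀ t < 0, AEStronglyMeasurable (v t) volume)
    (hsm : ContDiffOn ℝ (⊤ : ℕ∞) (Function.uncurry v) (Set.Iio 0 ×ˢ Set.univ))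
    (hun : ∀ t < 0, ∀ x, ⟪x - x₀, curl (v t) x⟫ = 0)
    (R : EuclideanSpace ℝ (Fin 3) ≃ₗᵢ[ℝ] EuclideanSpace ℝ (Fin 3)) {τ : ℝ} (hτ : τ ≤ 0)
    (hanti : ∀ s < 0, ∀ y, curl (v (s + τ)) (x₀ + R y) =
      -((R : EuclideanSpace ℝ (Fin 3) →L[ℝ] EuclideanSpace ℝ (Fin 3)).det • R (curl (v s) (x₀ + y)))) :
    ∀ t < 0, ∃ b : EuclideanSpace ℝ (Fin 3), ∀ x, v t x = b :=
  constantOfIrrotational v hB hsm (curl_eq_zero_of_curl_antiscrew v x₀ hB hm hsm hun R hτ hanti)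

/-- ★★★ **ANTI-PERIODIC VORTICITY IS TRIVIAL.**  Under the same standing hypotheses, if `curl v(s − τ) = −curl v(s)` for all `s < 0` (`τ > 0`), then
`curl v ≡ 0` on `(−∞,0) × ℝ³`. [cite: KochNadirashviliSereginSverak2009, Thm 5.2 (arXiv:0709.3599 pp. 9–10)] -/
theorem curl_eq_zero_of_curl_antiperiodic
    (v : ℝ → EuclideanSpace ℝ (Fin 3) → EuclideanSpace ℝ (Fin 3)) (x₀ : EuclideanSpace ℝ (Fin 3))
    (hB : Literature.Analysis.FluidPDE.IsBoundedAncientMildSolution 1 v)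
    (hm : ∀ t < 0, AEStronglyMeasurable (v t) volume)
    (hsm : ContDiffOn ℝ (⊤ : ℕ∞) (Function.uncurry v) (Set.Iio 0 ×ˢ Set.univ))
    (hun : ∀ t < 0, ∀ x, ⟪x - x₀, curl (v t) x⟫ = 0)
    {τ : ℝ} (hτ : 0 < τ) (hanti : ∀ s < 0, ∀ x, curl (v (s - τ)) x = -curl (v s) x) :
    ∀ t < 0, ∀ x, curl (v t) x = 0 := by
  refine curl_eq_zero_of_curl_antiscrew v x₀ hB hm hsm hun (LinearIsometryEquiv.refl ℝ (EuclideanSpace ℝ (Fin 3)))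
    (show -τ ≤ 0 by linarith) fun s hs y => ?_
  have hdet : ((LinearIsometryEquiv.refl ℝ (EuclideanSpace ℝ (Fin 3)) :
      EuclideanSpace ℝ (Fin 3) →L[ℝ] EuclideanSpace ℝ (Fin 3))).det = 1 := by
    have e : ((LinearIsometryEquiv.refl ℝ (EuclideanSpace ℝ (Fin 3)) :
        EuclideanSpace ℝ (Fin 3) →L[ℝ] EuclideanSpace ℝ (Fin 3))) = ContinuousLinearMap.id ℝ _ := by
      ext x i; rfl
    rw [e, ContinuousLinearMap.det, ContinuousLinearMap.coe_id, LinearMap.det_id]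
  rw [LinearIsometryEquiv.coe_refl, id, hdet, one_smul, show s + -τ = s - τ by ring]
  exact hanti s hs (x₀ + y)

/-- ★★★ **… HENCE SLICE-WISE CONSTANT.** [cite: KochNadirashviliSereginSverak2009, Thm 5.2 (arXiv:0709.3599 pp. 9–10)] -/
theorem constant_of_curl_antiperiodic
    (v : ℝ → EuclideanSpace ℝ (Fin 3) → EuclideanSpace ℝ (Fin 3)) (x₀ : EuclideanSpace ℝ (Fin 3))
    (hB : Literature.Analysis.FluidPDE.IsBoundedAncientMildSolution 1 v)
    (hm : ∀ t < 0, AEStronglyMeasurable (v t) volume)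
    (hsm : ContDiffOn ℝ (⊤ : ℕ∞) (Function.uncurry v) (Set.Iio 0 ×ˢ Set.univ))
    (hun : ∀ t < 0, ∀ x, ⟪x - x₀, curl (v t) x⟫ = 0)
    {τ : ℝ} (hτ : 0 < τ) (hanti : ∀ s < 0, ∀ x, curl (v (s - τ)) x = -curl (v s) x) :
    ∀ t < 0, ∃ b : EuclideanSpace ℝ (Fin 3), ∀ x, v t x = b :=
  constantOfIrrotational v hB hsm (curl_eq_zero_of_curl_antiperiodic v x₀ hB hm hsm hun hτ hanti)

end Summit.NavierStokesRegularity.NavierStokesRegularity.Theorems.PoloidalLiouville.Antidynamo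

end
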